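import Literature.Topology.FourManifolds.DehnNielsenBaerTorus
import HarnessLib

/-!
# Dehn–Nielsen–Baer: outer realisability is closed under composition; reduction to generators

Topic `Literature/Topology/FourManifolds`; third PROOF file of the named fact
`Literature.Topology.FourManifolds.DehnNielsenBaerSurfaceSmooth` (`DehnNielsenBaerSurface.lean`),
after `DehnNielsenBaerSurfaceProofs.lean` (point pushing, reductions to one model per genus) and
`DehnNielsenBaerTorus.lean` (genus `≤ 1` proved; reduction to the flower surfaces in genus `≥ 2`).
Theorems only; nothing is defined, no named fact is introduced.

*Outer realisability* of an automorphism `θ` of `π₁(M, x)` — the existence of a diffeomorphism `f`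
and a path `p` from `x` to `f x` with `f_* = β_p ∘ θ` (Farb–Margalit's `φ_*` read along a path,
§8.1; `β_p` Mathlib's `fundamentalGroupMulEquivOfPath p`, Hatcher Prop. 1.5) — holds for the
identity and for every inner automorphism with `f = id` (`exists_diffeomorph_path_map_eq_one`,
`exists_diffeomorph_path_map_eq_conj`: `id_* γ = β_{α⁻¹}(c γ c⁻¹)` for `c = [α]`), and is closed
under composition (`exists_diffeomorph_path_map_eq_mul`: `(f₂ f₁)_* = β_{p₂ · f₂∘p₁} ∘ θ₂ θ₁`, by the
naturality `f_* ∘ β_p = β_{f∘p} ∘ f_*`, `fundamentalGroup_map_fundamentalGroupMulEquivOfPath`, and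
`β_{δ·ε} = β_ε ∘ β_δ`).  Hence (`exists_diffeomorph_path_map_eq_of_mem_closure`) it holds on the
subgroup of `Aut π₁(M, x)` generated by the inner automorphisms and any set `S` of automorphisms
realised together with their inverses; and `dehnNielsenBaerSurfaceSmooth_of_flower_generators`
reduces the named fact to the realisation, for each `g ≥ 2`, of the elements (and inverses) of ONE
set of automorphisms of `π₁(∂V_g, x₀)` generating `Aut π₁` together with `Inn π₁`, on the flower
surface `∂V_g` — the form in which Dehn–Nielsen–Baer surjectivity is obtained from explicit
generators (Farb–Margalit (2012), Thm. 8.1 with the Dehn–Lickorish–Humphries generators, Thm. 4.1).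

## References

* B. Farb, D. Margalit, *A primer on mapping class groups*, PMS 49 (2012), Thm. 8.1 and §8.1
  (PDF pp. 190–191), Thm. 4.1. [FarbMargalit2012]
* A. Hatcher, *Algebraic Topology* (2002), §1.1, Prop. 1.5. [HatcherAT2002]
-/

open scoped Manifold ContDiff Topology
open Set Function

noncomputable section

namespace Literature.Topology.FourManifolds

open Literature.AlgebraicTopology.FundamentalGroup

/-! ### Outer realisability is closed under composition and inverses; reduction to generators -/

section Generators

variable {n : ℕ} {M : Type*} [TopologicalSpace M] [ChartedSpace (EuclideanSpace ℝ (Fin n)) M]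

/-- `π₁` of a composite of maps (Hatcher (2002), §1.1: `(φψ)_* = φ_* ψ_*`); private copy of
`fundamentalGroup_map_comp_apply` of `TrisectionFunctorGKNaturality.lean` (not imported here).
[cite: HatcherAT2002, §1.1 (p. 34)] -/
private theorem map_comp_apply_dnb {X Y Z : Type*} [TopologicalSpace X] [TopologicalSpace Y]
    [TopologicalSpace Z] (f : C(X, Y)) (g : C(Y, Z)) (x : X) (γ : FundamentalGroup X x) :
    FundamentalGroup.map (g.comp f) x γ = FundamentalGroup.map g (f x) (FundamentalGroup.map f x γ) := by
  induction γ using Quotient.ind with | _ ℓ =>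
  exact Path.Homotopic.Quotient.map_comp (p := Path.Homotopic.Quotient.mk ℓ) (f := f) (g := g)

/-- `π₁` of the identity map; private copy of `fundamentalGroup_map_id_apply` of
`TrisectionFunctorGKNaturality.lean` (not imported here). [cite: HatcherAT2002, §1.1 (p. 34)] -/
private theorem map_id_apply_dnb {X : Type*} [TopologicalSpace X] (x : X) (γ : FundamentalGroup X x) :
    FundamentalGroup.map (ContinuousMap.id X) x γ = γ := by
  induction γ using Quotient.ind with | _ ℓ =>
  change FundamentalGroup.fromPath ((Path.Homotopic.Quotient.mk ℓ).map (ContinuousMap.id X)) =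
    FundamentalGroup.fromPath (Path.Homotopic.Quotient.mk ℓ)
  rw [← Path.Homotopic.Quotient.mk_map]
  rfl

/-- **Naturality of the change of base point**: `f_* (β_p ℓ) = β_{f ∘ p} (f_* ℓ)` (Hatcher (2002), §1.1,
Prop. 1.5 with functoriality). [cite: HatcherAT2002, Prop. 1.5] -/
theorem fundamentalGroup_map_fundamentalGroupMulEquivOfPath {X Y : Type*} [TopologicalSpace X]
    [TopologicalSpace Y] (f : C(X, Y)) {x y : X} (p : Path x y) (ℓ : FundamentalGroup X x) :
    FundamentalGroup.map f y (FundamentalGroup.fundamentalGroupMulEquivOfPath p ℓ) =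
      FundamentalGroup.fundamentalGroupMulEquivOfPath (p.map f.continuous) (FundamentalGroup.map f x ℓ) := by
  induction ℓ using Quotient.ind with | _ γ =>
  change FundamentalGroup.fromPath ((Path.Homotopic.Quotient.mk (p.symm.trans (γ.trans p))).map f) =
    FundamentalGroup.fundamentalGroupMulEquivOfPath (p.map f.continuous)
      (FundamentalGroup.fromPath ((Path.Homotopic.Quotient.mk γ).map f))
  rw [← Path.Homotopic.Quotient.mk_map, ← Path.Homotopic.Quotient.mk_map,
    fundamentalGroupMulEquivOfPath_fromPath_eq_fromPath, Path.map_trans, Path.map_trans, Path.map_symm]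

/-- **Outer realisability of the identity** (by the identity and the constant path). [folklore] -/
theorem exists_diffeomorph_path_map_eq_one (x : M) :
    ∃ (f : M ≃ₘ⟮𝓡 n, 𝓡 n⟯ M) (p : Path x (f x)), ∀ γ,
      FundamentalGroup.map (⟨f, f.continuous⟩ : C(M, M)) x γ =
        FundamentalGroup.fundamentalGroupMulEquivOfPath p ((1 : FundamentalGroup M x ≃* FundamentalGroup M x) γ) := by
  refine ⟨Diffeomorph.refl _ M ∞, Path.refl x, fun γ => ?_⟩
  have hid : FundamentalGroup.map (⟨⇑(Diffeomorph.refl (𝓡 n) M ∞),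
      (Diffeomorph.refl (𝓡 n) M ∞).continuous⟩ : C(M, M)) x γ = γ :=
    map_id_apply_dnb x γ
  rw [hid]
  change γ = FundamentalGroup.fundamentalGroupMulEquivOfPath (Path.refl x) γ
  rw [fundamentalGroupMulEquivOfPath_refl_apply']

/-- **Inner automorphisms are outer-realised by the identity** and a loop: `id_* γ = β_α (c γ c⁻¹)`
for `[α] = c⁻¹` (Farb–Margalit (2012), §8.1: `φ_*` is well defined only in `Out π₁`).
[cite: FarbMargalit2012, Thm. 8.1 (the map σ to Out)] -/
theorem exists_diffeomorph_path_map_eq_conj (x : M) (c : FundamentalGroup M x) :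
    ∃ (f : M ≃ₘ⟮𝓡 n, 𝓡 n⟯ M) (p : Path x (f x)), ∀ γ,
      FundamentalGroup.map (⟨f, f.continuous⟩ : C(M, M)) x γ =
        FundamentalGroup.fundamentalGroupMulEquivOfPath p (MulAut.conj c γ) := by
  induction c using Quotient.ind with | _ α =>
  refine ⟨Diffeomorph.refl _ M ∞, α.symm, fun γ => ?_⟩
  have hid : FundamentalGroup.map (⟨⇑(Diffeomorph.refl (𝓡 n) M ∞),
      (Diffeomorph.refl (𝓡 n) M ∞).continuous⟩ : C(M, M)) x γ = γ :=
    map_id_apply_dnb x γ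
  rw [hid]
  change γ = FundamentalGroup.fundamentalGroupMulEquivOfPath α.symm
    (MulAut.conj (FundamentalGroup.fromPath (Path.Homotopic.Quotient.mk α)) γ)
  rw [fundamentalGroupMulEquivOfPath_loop_apply, MulAut.conj_apply]
  change γ = FundamentalGroup.fromPath (Path.Homotopic.Quotient.mk α.symm) *
    (FundamentalGroup.fromPath (Path.Homotopic.Quotient.mk α) * γ *
      (FundamentalGroup.fromPath (Path.Homotopic.Quotient.mk α))⁻¹) *
    (FundamentalGroup.fromPath (Path.Homotopic.Quotient.mk α.symm))⁻¹
  have hinv : FundamentalGroup.fromPath (Path.Homotopic.Quotient.mk α.symm) =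
      (FundamentalGroup.fromPath (Path.Homotopic.Quotient.mk α))⁻¹ := by
    rw [FundamentalGroup.inv_def, Path.Homotopic.Quotient.mk_symm]
  rw [hinv]
  group

/-- **Outer realisability is closed under composition**: if `(f₁, p₁)` realises `θ₁` and `(f₂, p₂)`
realises `θ₂` then `(f₂ ∘ f₁, p₂ · (f₂ ∘ p₁))` realises `θ₂ ∘ θ₁` (naturality of the change of base
point and `β_{δ·ε} = β_ε ∘ β_δ`). [cite: HatcherAT2002, Prop. 1.5 and §1.1] -/
theorem exists_diffeomorph_path_map_eq_mul {x : M}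
    {θ₁ θ₂ : FundamentalGroup M x ≃* FundamentalGroup M x}
    (h₁ : ∃ (f : M ≃ₘ⟮𝓡 n, 𝓡 n⟯ M) (p : Path x (f x)), ∀ γ,
      FundamentalGroup.map (⟨f, f.continuous⟩ : C(M, M)) x γ =
        FundamentalGroup.fundamentalGroupMulEquivOfPath p (θ₁ γ))
    (h₂ : ∃ (f : M ≃ₘ⟮𝓡 n, 𝓡 n⟯ M) (p : Path x (f x)), ∀ γ,
      FundamentalGroup.map (⟨f, f.continuous⟩ : C(M, M)) x γ =
        FundamentalGroup.fundamentalGroupMulEquivOfPath p (θ₂ γ)) :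
    ∃ (f : M ≃ₘ⟮𝓡 n, 𝓡 n⟯ M) (p : Path x (f x)), ∀ γ,
      FundamentalGroup.map (⟨f, f.continuous⟩ : C(M, M)) x γ =
        FundamentalGroup.fundamentalGroupMulEquivOfPath p ((θ₂ * θ₁) γ) := by
  obtain ⟨f₁, p₁, hf₁⟩ := h₁
  obtain ⟨f₂, p₂, hf₂⟩ := h₂
  refine ⟨f₁.trans f₂, p₂.trans (p₁.map f₂.continuous), fun γ => ?_⟩
  have e1 : FundamentalGroup.map (⟨⇑(f₁.trans f₂), (f₁.trans f₂).continuous⟩ : C(M, M)) x γ =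
      FundamentalGroup.map (⟨f₂, f₂.continuous⟩ : C(M, M)) (f₁ x)
        (FundamentalGroup.map (⟨f₁, f₁.continuous⟩ : C(M, M)) x γ) :=
    map_comp_apply_dnb ⟨f₁, f₁.continuous⟩ ⟨f₂, f₂.continuous⟩ x γ
  rw [e1, hf₁, fundamentalGroup_map_fundamentalGroupMulEquivOfPath, hf₂]
  change _ = FundamentalGroup.fundamentalGroupMulEquivOfPath (p₂.trans (p₁.map f₂.continuous))
    (θ₂ (θ₁ γ))
  rw [fundamentalGroupMulEquivOfPath_trans_apply]

/-- **Reduction of outer realisability to generators**: if every element of `S ⊆ Aut π₁(M, x)` and its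
inverse are outer-realised by diffeomorphisms, then so is every element of the subgroup generated by
`S` and the inner automorphisms (inner automorphisms need no diffeomorphism: `φ_*` is read in
`Out π₁`).  This is the form in which Dehn–Nielsen–Baer surjectivity is usually consumed: realise a
generating set of `Out π₁(S_g)` (Farb–Margalit (2012), Thm. 8.1 with §4.4.4 / Thm. 4.1, Dehn–Lickorish
generators). [cite: FarbMargalit2012, Thm. 8.1] -/
theorem exists_diffeomorph_path_map_eq_of_mem_closure {x : M}
    (S : Set (FundamentalGroup M x ≃* FundamentalGroup M x))
    (hS : ∀ θ ∈ S, ∃ (f : M ≃ₘ⟮𝓡 n, 𝓡 n⟯ M) (p : Path x (f x)), ∀ γ,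
      FundamentalGroup.map (⟨f, f.continuous⟩ : C(M, M)) x γ =
        FundamentalGroup.fundamentalGroupMulEquivOfPath p (θ γ))
    (hS' : ∀ θ ∈ S, ∃ (f : M ≃ₘ⟮𝓡 n, 𝓡 n⟯ M) (p : Path x (f x)), ∀ γ,
      FundamentalGroup.map (⟨f, f.continuous⟩ : C(M, M)) x γ =
        FundamentalGroup.fundamentalGroupMulEquivOfPath p (θ⁻¹ γ))
    {θ : FundamentalGroup M x ≃* FundamentalGroup M x}
    (hθ : θ ∈ Subgroup.closure (S ∪ Set.range (MulAut.conj (G := FundamentalGroup M x)))) :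
    ∃ (f : M ≃ₘ⟮𝓡 n, 𝓡 n⟯ M) (p : Path x (f x)), ∀ γ,
      FundamentalGroup.map (⟨f, f.continuous⟩ : C(M, M)) x γ =
        FundamentalGroup.fundamentalGroupMulEquivOfPath p (θ γ) := by
  induction hθ using Subgroup.closure_induction'' with
  | one => exact exists_diffeomorph_path_map_eq_one x
  | mem θ hθ =>
    rcases hθ with hθ | ⟨c, rfl⟩
    · exact hS θ hθ
    · exact exists_diffeomorph_path_map_eq_conj x c
  | inv_mem θ hθ =>
    rcases hθ with hθ | ⟨c, rfl⟩
    · exact hS' θ hθ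
    · rw [← map_inv]
      exact exists_diffeomorph_path_map_eq_conj x c⁻¹
  | mul θ₁ θ₂ _ _ ih₁ ih₂ => exact exists_diffeomorph_path_map_eq_mul ih₂ ih₁

/-- **`DehnNielsenBaerSurfaceSmooth` from the realisation of GENERATORS on the flower surfaces**: it
suffices that for each `g ≥ 2`, at one base point `x₀` of `∂V_g`, some set `S` of automorphisms of
`π₁(∂V_g, x₀)` generating `Aut π₁` together with the inner automorphisms consists of automorphisms
outer-realised, with their inverses, by diffeomorphisms (e.g. the automorphisms of the Dehn–Lickorish /
Humphries twists and of one reflection, Farb–Margalit (2012), Thm. 4.1 and §8.1).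
[cite: FarbMargalit2012, Thm. 8.1 and Thm. 4.1] -/
theorem dehnNielsenBaerSurfaceSmooth_of_flower_generators
    (hgen : ∀ (g : ℕ) (hg : 2 ≤ g), ∃ (x₀ : (𝓡∂ 3).boundary (FlowerModel.FlowerHandlebody hg))
      (S : Set (FundamentalGroup ((𝓡∂ 3).boundary (FlowerModel.FlowerHandlebody hg)) x₀ ≃*
        FundamentalGroup ((𝓡∂ 3).boundary (FlowerModel.FlowerHandlebody hg)) x₀)),
      Subgroup.closure (S ∪ Set.range (MulAut.conj
        (G := FundamentalGroup ((𝓡∂ 3).boundary (FlowerModel.FlowerHandlebody hg)) x₀))) = ⊤ ∧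
      ∀ θ ∈ S, (∃ (f : (𝓡∂ 3).boundary (FlowerModel.FlowerHandlebody hg) ≃ₘ⟮𝓡 2, 𝓡 2⟯
            (𝓡∂ 3).boundary (FlowerModel.FlowerHandlebody hg)) (p : Path x₀ (f x₀)), ∀ γ,
          FundamentalGroup.map (⟨f, f.continuous⟩ : C(_, _)) x₀ γ =
            FundamentalGroup.fundamentalGroupMulEquivOfPath p (θ γ)) ∧
        (∃ (f : (𝓡∂ 3).boundary (FlowerModel.FlowerHandlebody hg) ≃ₘ⟮𝓡 2, 𝓡 2⟯
            (𝓡∂ 3).boundary (FlowerModel.FlowerHandlebody hg)) (p : Path x₀ (f x₀)), ∀ γ,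
          FundamentalGroup.map (⟨f, f.continuous⟩ : C(_, _)) x₀ γ =
            FundamentalGroup.fundamentalGroupMulEquivOfPath p (θ⁻¹ γ))) :
    DehnNielsenBaerSurfaceSmooth := by
  refine dehnNielsenBaerSurfaceSmooth_of_flower fun g hg => ?_
  obtain ⟨x₀, S, hS, hreal⟩ := hgen g hg
  refine ⟨x₀, fun θ => exists_diffeomorph_path_map_eq_of_mem_closure S (fun θ hθ => (hreal θ hθ).1)
    (fun θ hθ => (hreal θ hθ).2) ?_⟩
  rw [hS]
  exact Subgroup.mem_top θ

end Generators

end Literature.Topology.FourManifolds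

end
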